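import Literature.NumberTheory.EllipticCurves.TwoVariablePadicLFunctionAllBranchesProofs
import Literature.NumberTheory.EllipticCurves.PAdicTwoVariableTransformUnits
import Literature.NumberTheory.EllipticCurves.PAdicLFunctionInterpolationHoldsProofs
import HarnessLib

/-!
# The Greenberg–Stevens / Kitagawa fact on all branches from Kitagawa's MEASURE
# (Delbourgo 2008, Thm. 4.11 as printed): proofs only

Topic `Literature/NumberTheory/EllipticCurves`.  THEOREMS ONLY (no definition, no named fact; D-0026).
Companion of the named fact
`Literature.NumberTheory.EllipticCurves.greenbergStevens_kitagawa_twoVariable_interpolation_allBranches`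
(`TwoVariablePadicLFunction.lean`) and of its classical glue
`greenbergStevens_kitagawa_twoVariable_interpolation_allBranches_of_hidaFamily_of_kitagawa`
(`TwoVariablePadicLFunctionAllBranchesProofs.lean`), which reduces the fact to two Λ-adic inputs:
(H) the Hida family `A` through `f_E^{(α)}` with `𝕋_𝔪 = Λ` under `(Br)`, and (K) `hKitagawaAll`, the
two-variable `p`-adic `L`-function OF THAT FAMILY in SERIES form — integral series
`F_c ∈ ℤ_p⟦X, Y⟧`, one for each Teichmüller branch `ω^c`, whose weight-`2` row is `∝ L_p(E, T)` and
whose values at `(x_k, y_n) = ((1+p)^{k-2} − 1, (1+p)^{n-1} − 1)` interpolate the critical values of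
the members.

Kitagawa's theorem is PRINTED in measure form (Delbourgo 2008, Thm. 4.11 [GS, Ki]; Kitagawa 1994,
Thm. 1.1; Greenberg–Stevens 1993, Thm. 5.15): a bounded measure `μ_𝐟` on `ℤ_{p,M}^× × ℤ_p` with

  `∫_{ℤ_{p,M}^× × ℤ_p^×} ψ^{-1}(x) x^j ε(y/x) (y/x)^{k-k₀} dμ_𝐟(x, y)`
  `   = j! M^j p^{nj} (1 − ψ^{-1}(p) p^j / a_p(𝐟_{P_k})) a_p(𝐟_{P_k})^{-n} × Per_{𝐟,P_k} × G(ψ^{-1}) L(𝐟_{P_k}, ψ, j+1) / ((2πi)^j Ω_{P_k})`,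

and "switching between measures and power series is permissible" (Delbourgo, p. 99).  This file
proves that switch for the shape used by the tree: from a bounded `ℤ_p`-valued distribution `ν` on
`ℤ_p × ℤ_p` in the coordinates `(z, x) = (y/x, x)` (`PAdicDistributionIntegral.BoundedDistribution`,
`‖ν‖ ≤ 1`, supported on pairs of units), whose `x`-marginal on unit classes is `c₀ · μ_{f,α}`
(`msdMeasure`, the weight-`2` specialisation) and whose moments `∫ z^{k-2} x^{n-1} dν` at the
arithmetic points are the printed right-hand sides, we obtain `hKitagawaAll` with
`F_c := BoundedDistribution.branchSeries ν c` (`PAdicTwoVariableTransformUnits.lean`):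

* integrality — `isPadicInt_branchSeries`;
* the weight-`2` row — `coeff_branchSeries_zero_eq_mul_padicLCoeff`: `coeff_{(0,i)} F_0 = c₀ · padicLCoeff f α i`,
  by passing to the limit in `Σ_{(η₁,η₂)} RS(ν^{(η₁,η₂)}, (t choose i), n) = c₀ · padicLRiemannSum f α i n`
  (`sum_riemannSum_classDist_eq`; convergence on the right is the tree's unconditional
  `tendsto_padicLRiemannSum_of_isNewformOf`, Mazur–Tate–Teitelbaum 1986, §I.11–I.13);
* the values — `padicEval₂_branchSeries_arith`: `F_{(n-1) mod (p-1)}(x_k, y_n) = ∫ z^{k-2} x^{n-1} dν`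
  (`padicEval₂_branchSeries_eq_integral` with `γ = 1 + p`, `τ = p − 1`).

Main results: `kitagawaAll_of_kitagawaMeasure` (measure form ⇒ series form) and
`greenbergStevens_kitagawa_twoVariable_interpolation_allBranches_of_hidaFamily_of_kitagawaMeasure`
(the fact from (H) and the measure form of (K)).  Neither (H) nor (K) is a fact of the tree; they are
hypotheses here (D-0026) and the remaining Λ-adic theory (Hida control for `Γ₀(N) ∩ Γ₁(p^∞)`;
Kitagawa's Λ-adic modular symbols).  Brick B1e of the bottom-up plan recorded with the named fact.

## References

* R. Greenberg, G. Stevens, *p-adic L-functions and p-adic periods of modular forms*, Invent. Math.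
  111 (1993), Thm. 5.15. [GreenbergStevens1993]
* K. Kitagawa, *On standard p-adic L-functions of families of elliptic cusp forms*, Contemp. Math.
  165 (1994), Thm. 1.1. [Kitagawa1994]
* D. Delbourgo, *Elliptic Curves and Big Galois Representations*, LMS LNS 356 (2008), Thm. 4.11,
  Def. 4.12, p. 99–100. [Delbourgo2008]
* B. Mazur, J. Tate, J. Teitelbaum, Invent. Math. 84 (1986), §I.10–I.13. [MazurTateTeitelbaum1986Invent]
-/

noncomputable section

open Filter Topology
open Complex UpperHalfPlane CongruenceSubgroup
open scoped MatrixGroups ModularForm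

namespace Literature.NumberTheory.EllipticCurves

open Literature.NumberTheory.EllipticCurves.ModularForms

variable {p : ℕ} [Fact p.Prime]

/-! ### From Kitagawa's measure (Delbourgo Thm. 4.11 as printed) to the series form `hKitagawaAll` -/

section MeasureForm

namespace BoundedDistribution

variable (ν : BoundedDistribution (padicIntSq p) ℚ_[p])

/-- **Rearranging a sum over pairs of classes by the `x`-class**:
`Σ_{(η₁,η₂)} Σ_{(s,t)} F = Σ_{η₂} Σ_t Σ_{η₁} Σ_s F`. [folklore] -/
theorem sum_prod_sum_prod_eq {R Z M : Type*} [Fintype R] [Fintype Z] [AddCommMonoid M]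
    (F : R → R → Z → Z → M) :
    ∑ ηη : R × R, ∑ st : Z × Z, F ηη.1 ηη.2 st.1 st.2 = ∑ η₂, ∑ t, ∑ η₁, ∑ s, F η₁ η₂ s t := by
  rw [Fintype.sum_prod_type, Finset.sum_comm]
  refine Finset.sum_congr rfl fun η₂ _ => ?_
  simp_rw [Fintype.sum_prod_type]
  calc ∑ η₁, ∑ s, ∑ t, F η₁ η₂ s t = ∑ η₁, ∑ t, ∑ s, F η₁ η₂ s t :=
        Finset.sum_congr rfl fun _ _ => Finset.sum_comm
    _ = ∑ t, ∑ η₁, ∑ s, F η₁ η₂ s t := Finset.sum_comm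

/-- **The `(0, i)` coefficient of the trivial branch `F_0`** is `Σ_{(η₁,η₂)} ∫ (t choose i) dν^{(η₁,η₂)}`
(the weight-`2` row `X = 0` of the two-variable transform). [folklore] -/
theorem coeff_single_one_branchSeries_zero (i : ℕ) :
    MvPowerSeries.coeff (Finsupp.single 1 i) (ν.branchSeries 0) =
      ∑ ηη : rootsOfUnity (torsionOrder p) ℤ_[p] × rootsOfUnity (torsionOrder p) ℤ_[p],
        (ν.classDist ηη.1 ηη.2).integral (mahlerMonomial 0 i) := by
  rw [branchSeries_def, transformSum_def, map_sum]
  refine Finset.sum_congr rfl fun ηη _ => ?_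
  rw [pow_zero, map_one, one_mul, coeff_transform]
  simp

/-- The level-`n` Riemann sum of `(t choose i)` against `ν^{(η₁,η₂)}`. [folklore] -/
theorem riemannSum_classDist_mahlerMonomial_zero (η₁ η₂ : rootsOfUnity (torsionOrder p) ℤ_[p])
    (i n : ℕ) :
    (ν.classDist η₁ η₂).riemannSum (mahlerMonomial 0 i) n =
      ∑ st : ZMod (p ^ n) × ZMod (p ^ n),
        ν.μ (cyclotomicExponent p + n) (classOf' n η₁ st.1, classOf' n η₂ st.2) *
          (st.2.val.choose i : ℚ_[p]) := by
  rw [riemannSum_def]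
  refine Finset.sum_congr rfl fun st _ => ?_
  rw [classDist_μ, ProfiniteTower.prod_repr, ProfiniteTower.padicInt_repr,
    ProfiniteTower.padicInt_repr, mahlerMonomial_apply, mahler_natCast_eq, mahler_natCast_eq,
    Nat.choose_zero_right, Nat.cast_one, one_mul, PadicInt.coe_natCast]

/-- **The weight-`2` row of the Riemann sums**: if the `x`-marginal of `ν` on unit classes is
`c₀ · μ_{f,α}` (`msdMeasure`), then `Σ_{(η₁,η₂)} RS(ν^{(η₁,η₂)}, (t choose i), n) = c₀ · padicLRiemannSum f α i n`.
[folklore] -/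
theorem sum_riemannSum_classDist_eq {N : ℕ} (f : CuspForm (Gamma0 N) 2) {α c₀ : ℚ_[p]}
    (hm : ∀ (n : ℕ) (η₂ : rootsOfUnity (torsionOrder p) ℤ_[p]) (t : ZMod (p ^ n)),
      ∑ η₁ : rootsOfUnity (torsionOrder p) ℤ_[p], ∑ s : ZMod (p ^ n),
          ν.μ (cyclotomicExponent p + n) (classOf' n η₁ s, classOf' n η₂ t) =
        c₀ * msdMeasure f α (n + cyclotomicExponent p) (classOf p n η₂ t))
    (i n : ℕ) :
    ∑ ηη : rootsOfUnity (torsionOrder p) ℤ_[p] × rootsOfUnity (torsionOrder p) ℤ_[p],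
        (ν.classDist ηη.1 ηη.2).riemannSum (mahlerMonomial 0 i) n =
      c₀ * padicLRiemannSum f α i n := by
  simp_rw [riemannSum_classDist_mahlerMonomial_zero]
  rw [sum_prod_sum_prod_eq (F := fun η₁ η₂ (s t : ZMod (p ^ n)) =>
    ν.μ (cyclotomicExponent p + n) (classOf' n η₁ s, classOf' n η₂ t) * (t.val.choose i : ℚ_[p]))]
  rw [padicLRiemannSum, finsum_eq_sum_of_fintype, Finset.mul_sum]
  refine Finset.sum_congr rfl fun η₂ _ => ?_
  rw [Finset.mul_sum]
  refine Finset.sum_congr rfl fun t _ => ?_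
  simp_rw [← Finset.sum_mul]
  rw [hm n η₂ t, classOf_def, mul_assoc]

open IsDedekindDomain in
/-- **The weight-`2` row of `F_0` is `c₀ · L_p(f, α, T)`**: for the newform `f` of `E = W/ℚ` at a
good ordinary prime and `ν` with `x`-marginal `c₀ · μ_{f,α}` on unit classes,
`coeff_{(0,i)} F_0 = c₀ · padicLCoeff f α i` (limits of the two sides of
`sum_riemannSum_classDist_eq`; convergence of the right side is
`tendsto_padicLRiemannSum_of_isNewformOf`, Mazur–Tate–Teitelbaum 1986, §I.11–I.13).
[cite: MazurTateTeitelbaum1986Invent, §I.13] -/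
theorem coeff_branchSeries_zero_eq_mul_padicLCoeff {N : ℕ} [NeZero N] {f : CuspForm (Gamma0 N) 2}
    {W : WeierstrassCurve ℚ} [W.IsGloballyMinimal] [W.IsElliptic]
    (hord : IsOrdinaryAt W p) (hf : IsNewformOf W f) {c₀ : ℚ_[p]}
    (hm : ∀ (n : ℕ) (η₂ : rootsOfUnity (torsionOrder p) ℤ_[p]) (t : ZMod (p ^ n)),
      ∑ η₁ : rootsOfUnity (torsionOrder p) ℤ_[p], ∑ s : ZMod (p ^ n),
          ν.μ (cyclotomicExponent p + n) (classOf' n η₁ s, classOf' n η₂ t) =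
        c₀ * msdMeasure f (unitRoot W p : ℚ_[p]) (n + cyclotomicExponent p) (classOf p n η₂ t))
    (i : ℕ) :
    MvPowerSeries.coeff (Finsupp.single 1 i) (ν.branchSeries 0) =
      c₀ * padicLCoeff f (unitRoot W p : ℚ_[p]) i := by
  rw [coeff_single_one_branchSeries_zero]
  have h1 : Tendsto (fun n => ∑ ηη : rootsOfUnity (torsionOrder p) ℤ_[p] ×
      rootsOfUnity (torsionOrder p) ℤ_[p], (ν.classDist ηη.1 ηη.2).riemannSum (mahlerMonomial 0 i) n)
      atTop (𝓝 (∑ ηη : rootsOfUnity (torsionOrder p) ℤ_[p] × rootsOfUnity (torsionOrder p) ℤ_[p],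
        (ν.classDist ηη.1 ηη.2).integral (mahlerMonomial 0 i))) :=
    tendsto_finsetSum _ fun ηη _ =>
      (ν.classDist ηη.1 ηη.2).tendsto_riemannSum_integral (uniformContinuous_mahlerMonomial 0 i)
  have h2 : Tendsto (fun n => ∑ ηη : rootsOfUnity (torsionOrder p) ℤ_[p] ×
      rootsOfUnity (torsionOrder p) ℤ_[p], (ν.classDist ηη.1 ηη.2).riemannSum (mahlerMonomial 0 i) n)
      atTop (𝓝 (c₀ * padicLCoeff f (unitRoot W p : ℚ_[p]) i)) :=
    ((tendsto_padicLRiemannSum_of_isNewformOf hord hf i).const_mul c₀).congr fun n =>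
      (ν.sum_riemannSum_classDist_eq f hm i n).symm
  exact tendsto_nhds_unique h1 h2

/-- **The branch series at an arithmetic point** `(x_k, y_n) = ((1+p)^{k-2} − 1, (1+p)^{n-1} − 1)`,
`p ≥ 5`, `k > 2`, `(p − 1) ∣ (k − 2)`: `F_{(n-1) mod (p-1)}(x_k, y_n) = ∫ z^{k-2} x^{n-1} dν(z, x)`
(`padicEval₂_branchSeries_eq_integral` with `γ = 1 + p`, `τ = p − 1`, `a = k − 2`, `b = n − 1`,
`c = (n − 1) mod (p − 1)`) — the left-hand side of Delbourgo 2008, Thm. 4.11 (`M = 1`, `ψ = ω^{1-n}`-part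
absorbed in the branch, `j = n − 1`, `k₀ = 2`) in the coordinates `(z, x) = (y/x, x)`.
[cite: Delbourgo2008, Thm. 4.11] -/
theorem padicEval₂_branchSeries_arith (hν : ν.bound ≤ 1)
    (hsupp : ∀ (L : ℕ) (c : ZMod (p ^ L) × ZMod (p ^ L)), 1 ≤ L → ¬ (IsUnit c.1 ∧ IsUnit c.2) →
      ν.μ L c = 0)
    (hp5 : 5 ≤ p) {k : ℤ} (hk : 2 < k) (hpk : ((p : ℤ) - 1) ∣ (k - 2)) (n : ℕ) :
    padicEval₂ (ν.branchSeries ((n - 1) % (p - 1))) ((1 + (p : ℚ_[p])) ^ (k - 2) - 1)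
        ((1 + (p : ℚ_[p])) ^ (n - 1) - 1) =
      ν.integral fun zx => (zx.1 : ℚ_[p]) ^ (k - 2).toNat * (zx.2 : ℚ_[p]) ^ (n - 1) := by
  have hp2 : p ≠ 2 := by omega
  have hγ : (cyclotomicGenerator p : ℚ_[p]) = 1 + (p : ℚ_[p]) := by
    rw [cyclotomicGenerator, cyclotomicExponent, if_neg hp2, pow_one, Nat.cast_add, Nat.cast_one]
  have hτ : torsionOrder p = p - 1 := by rw [torsionOrder_eq, if_neg hp2]
  obtain ⟨a, ha⟩ : ∃ a : ℕ, k - 2 = a := Int.eq_ofNat_of_zero_le (by omega)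
  have hτa : torsionOrder p ∣ a := by
    rw [hτ]
    have h1 : ((p - 1 : ℕ) : ℤ) ∣ (a : ℤ) := by
      rw [Nat.cast_sub (Fact.out : p.Prime).one_le, Nat.cast_one, ← ha]; exact hpk
    exact Int.natCast_dvd_natCast.mp h1
  have hcb : (n - 1) % (p - 1) ≡ n - 1 [MOD torsionOrder p] := by rw [hτ]; exact Nat.mod_modEq _ _
  rw [ha, zpow_natCast, Int.toNat_natCast, ← hγ]
  exact ν.padicEval₂_branchSeries_eq_integral hν hsupp hτa hcb

end BoundedDistribution

open Literature.NumberTheory.EllipticCurves.ModularForms in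
/-- **Kitagawa's theorem in measure form implies the series form `hKitagawaAll`.**  The measure form
is Delbourgo 2008, Thm. 4.11 [GS, Ki] as printed, for the Hida family `A` through `f_E^{(α)}` with
`𝕀 = Λ` (`M = 1`, trivial `ε`, base weight `k₀ = 2`), in the coordinates `(z, x) = (y/x, x)` on
`ℤ_p^× × ℤ_p^×`: a bounded `ℤ_p`-valued measure `ν` (`BoundedDistribution` on `ℤ_p × ℤ_p` with
`‖ν‖ ≤ 1` supported on pairs of units) whose `x`-marginal is `Per_2 · μ_{f,α}` (the weight-`2`
specialisation, Mazur–Tate–Teitelbaum 1986, §I.10) and whose moments `∫ z^{k-2} x^{n-1} dν` at the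
arithmetic points are `Per_k × (1 − p^{n-1}/u) × (n−1)!-normalised L-values / Ω_k` (Thm. 4.11 with
`j = n − 1`).  The series form (`F_c ∈ ℤ_p⟦X,Y⟧`, weight-`2` row, value interpolation) follows with
`F_c := branchSeries ν c` by `isPadicInt_branchSeries`, `coeff_branchSeries_zero_eq_mul_padicLCoeff`
and `padicEval₂_branchSeries_arith` ("switching between measures and power series is permissible",
Delbourgo p. 99). [cite: Delbourgo2008, Thm. 4.11, Def. 4.12, p. 99] -/
theorem kitagawaAll_of_kitagawaMeasure
    (hMeas : ∀ (W : WeierstrassCurve ℚ) [W.IsElliptic] [W.IsGloballyMinimal]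
      (_ : NeZero (W.conductorNorm ℤ)) (p : ℕ) [Fact p.Prime], 5 ≤ p → W.HasGoodReductionAtPrime p →
      ¬ (p : ℤ) ∣ W.frobeniusTrace p → ∀ A : ℕ → PowerSeries ℚ_[p],
      ((∀ n, IsPadicInt (A n)) ∧
          (∀ n : ℕ, PowerSeries.constantCoeff (A n) =
            ((W.LFunction n : ℤ) : ℚ_[p]) -
              (((W.LFunction p : ℤ) : ℚ_[p]) - (unitRoot W p : ℚ_[p])) *
                (if p ∣ n then ((W.LFunction (n / p) : ℤ) : ℚ_[p]) else 0)) ∧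
          (∀ k : ℤ, 2 < k → ((p : ℤ) - 1) ∣ (k - 2) →
            ∃ (g : CuspForm (CongruenceSubgroup.Gamma0 (W.conductorNorm ℤ)) k)
              (ι₀ : PadicAlgCl p ≃+* ℂ) (u : ℂ), IsNewform0 g ∧
              u ^ 2 - (qExpansion 1 ⇑g).coeff p * u + (p : ℂ) ^ (k - 1) = 0 ∧
              ∀ n : ℕ, ι₀.symm ((qExpansion 1 ⇑(iota (W.conductorNorm ℤ) (W.conductorNorm ℤ * p) 1 k
                  (mul_dvd_mul_left _ (one_dvd _)) g - ((qExpansion 1 ⇑g).coeff p - u) •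
                  iota (W.conductorNorm ℤ) (W.conductorNorm ℤ * p) p k dvd_rfl g)).coeff n) =
                algebraMap ℚ_[p] (PadicAlgCl p) (padicEval (A n) ((1 + (p : ℚ_[p])) ^ (k - 2) - 1)))) →
      ∃ ν : BoundedDistribution (padicIntSq p) ℚ_[p], ν.bound ≤ 1 ∧
        (∀ (L : ℕ) (c : ZMod (p ^ L) × ZMod (p ^ L)), 1 ≤ L → ¬ (IsUnit c.1 ∧ IsUnit c.2) →
          ν.μ L c = 0) ∧
        (∀ f : CuspForm (CongruenceSubgroup.Gamma0 (W.conductorNorm ℤ)) 2, IsNewformOf W f →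
          ∃ c₀ : ℚ_[p], c₀ ≠ 0 ∧
            ∀ (n : ℕ) (η₂ : rootsOfUnity (torsionOrder p) ℤ_[p]) (t : ZMod (p ^ n)),
              ∑ η₁ : rootsOfUnity (torsionOrder p) ℤ_[p], ∑ s : ZMod (p ^ n),
                  ν.μ (cyclotomicExponent p + n)
                    (BoundedDistribution.classOf' n η₁ s, BoundedDistribution.classOf' n η₂ t) =
                c₀ * msdMeasure f (unitRoot W p : ℚ_[p]) (n + cyclotomicExponent p)
                  (classOf p n η₂ t)) ∧
        (∀ (ι₀ : PadicAlgCl p ≃+* ℂ) (k : ℤ)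
          (g : CuspForm (CongruenceSubgroup.Gamma0 (W.conductorNorm ℤ)) k) (u : ℂ),
          2 < k → ((p : ℤ) - 1) ∣ (k - 2) → IsNewform0 g →
          u ^ 2 - (qExpansion 1 ⇑g).coeff p * u + (p : ℂ) ^ (k - 1) = 0 →
          (∀ n : ℕ, ι₀.symm ((qExpansion 1 ⇑(iota (W.conductorNorm ℤ) (W.conductorNorm ℤ * p) 1 k
              (mul_dvd_mul_left _ (one_dvd _)) g - ((qExpansion 1 ⇑g).coeff p - u) •
              iota (W.conductorNorm ℤ) (W.conductorNorm ℤ * p) p k dvd_rfl g)).coeff n) =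
            algebraMap ℚ_[p] (PadicAlgCl p) (padicEval (A n) ((1 + (p : ℚ_[p])) ^ (k - 2) - 1))) →
          ∃ (Per : PadicAlgCl p) (Ω : ℂ), Per ≠ 0 ∧ Ω ≠ 0 ∧
            ∀ n : ℕ, 0 < n → (n : ℤ) < k → Odd n →
              algebraMap ℚ_[p] (PadicAlgCl p)
                  (ν.integral fun zx => (zx.1 : ℚ_[p]) ^ (k - 2).toNat * (zx.2 : ℚ_[p]) ^ (n - 1)) =
                Per * ι₀.symm ((1 - (p : ℂ) ^ (n - 1) / u) *
                  ((2 * Real.pi : ℂ) ^ n *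
                    completedLValue
                      (iota (W.conductorNorm ℤ) (W.conductorNorm ℤ * p) 1 k
                          (mul_dvd_mul_left _ (one_dvd _)) g -
                        ((qExpansion 1 ⇑g).coeff p - u) •
                          iota (W.conductorNorm ℤ) (W.conductorNorm ℤ * p) p k dvd_rfl g) n) /
                  ((2 * Real.pi * Complex.I) ^ (n - 1) * Ω)))) :
    ∀ (W : WeierstrassCurve ℚ) [W.IsElliptic] [W.IsGloballyMinimal]
      (_ : NeZero (W.conductorNorm ℤ)) (p : ℕ) [Fact p.Prime], 5 ≤ p → W.HasGoodReductionAtPrime p →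
      ¬ (p : ℤ) ∣ W.frobeniusTrace p → ∀ A : ℕ → PowerSeries ℚ_[p],
      ((∀ n, IsPadicInt (A n)) ∧
          (∀ n : ℕ, PowerSeries.constantCoeff (A n) =
            ((W.LFunction n : ℤ) : ℚ_[p]) -
              (((W.LFunction p : ℤ) : ℚ_[p]) - (unitRoot W p : ℚ_[p])) *
                (if p ∣ n then ((W.LFunction (n / p) : ℤ) : ℚ_[p]) else 0)) ∧
          (∀ k : ℤ, 2 < k → ((p : ℤ) - 1) ∣ (k - 2) →
            ∃ (g : CuspForm (CongruenceSubgroup.Gamma0 (W.conductorNorm ℤ)) k)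
              (ι₀ : PadicAlgCl p ≃+* ℂ) (u : ℂ), IsNewform0 g ∧
              u ^ 2 - (qExpansion 1 ⇑g).coeff p * u + (p : ℂ) ^ (k - 1) = 0 ∧
              ∀ n : ℕ, ι₀.symm ((qExpansion 1 ⇑(iota (W.conductorNorm ℤ) (W.conductorNorm ℤ * p) 1 k
                  (mul_dvd_mul_left _ (one_dvd _)) g - ((qExpansion 1 ⇑g).coeff p - u) •
                  iota (W.conductorNorm ℤ) (W.conductorNorm ℤ * p) p k dvd_rfl g)).coeff n) =
                algebraMap ℚ_[p] (PadicAlgCl p) (padicEval (A n) ((1 + (p : ℚ_[p])) ^ (k - 2) - 1)))) →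
      ∃ F : ℕ → MvPowerSeries (Fin 2) ℚ_[p], (∀ c, IsPadicInt (F c)) ∧
        (∀ f : CuspForm (CongruenceSubgroup.Gamma0 (W.conductorNorm ℤ)) 2, IsNewformOf W f →
          ∃ c : PadicAlgCl p, c ≠ 0 ∧ ∀ i : ℕ,
            algebraMap ℚ_[p] (PadicAlgCl p) (MvPowerSeries.coeff (Finsupp.single 1 i) (F 0)) =
              c * algebraMap ℚ_[p] (PadicAlgCl p)
                (PowerSeries.coeff i (padicLFunction f (unitRoot W p : ℚ_[p])))) ∧
        (∀ (ι₀ : PadicAlgCl p ≃+* ℂ) (k : ℤ)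
          (g : CuspForm (CongruenceSubgroup.Gamma0 (W.conductorNorm ℤ)) k) (u : ℂ),
          2 < k → ((p : ℤ) - 1) ∣ (k - 2) → IsNewform0 g →
          u ^ 2 - (qExpansion 1 ⇑g).coeff p * u + (p : ℂ) ^ (k - 1) = 0 →
          (∀ n : ℕ, ι₀.symm ((qExpansion 1 ⇑(iota (W.conductorNorm ℤ) (W.conductorNorm ℤ * p) 1 k
              (mul_dvd_mul_left _ (one_dvd _)) g - ((qExpansion 1 ⇑g).coeff p - u) •
              iota (W.conductorNorm ℤ) (W.conductorNorm ℤ * p) p k dvd_rfl g)).coeff n) =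
            algebraMap ℚ_[p] (PadicAlgCl p) (padicEval (A n) ((1 + (p : ℚ_[p])) ^ (k - 2) - 1))) →
          ∃ (Per : PadicAlgCl p) (Ω : ℂ), Per ≠ 0 ∧ Ω ≠ 0 ∧
            ∀ n : ℕ, 0 < n → (n : ℤ) < k → Odd n →
              algebraMap ℚ_[p] (PadicAlgCl p)
                  (padicEval₂ (F ((n - 1) % (p - 1))) ((1 + (p : ℚ_[p])) ^ (k - 2) - 1)
                    ((1 + (p : ℚ_[p])) ^ (n - 1) - 1)) =
                Per * ι₀.symm ((1 - (p : ℂ) ^ (n - 1) / u) *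
                  ((2 * Real.pi : ℂ) ^ n *
                    completedLValue
                      (iota (W.conductorNorm ℤ) (W.conductorNorm ℤ * p) 1 k
                          (mul_dvd_mul_left _ (one_dvd _)) g -
                        ((qExpansion 1 ⇑g).coeff p - u) •
                          iota (W.conductorNorm ℤ) (W.conductorNorm ℤ * p) p k dvd_rfl g) n) /
                  ((2 * Real.pi * Complex.I) ^ (n - 1) * Ω))) := by
  intro W _ _ hN p _ hp5 hgood hap A hA
  obtain ⟨ν, hν1, hsupp, hmarg, hinterp⟩ := hMeas W hN p hp5 hgood hap A hA
  refine ⟨fun c => ν.branchSeries c, fun c => ν.isPadicInt_branchSeries hν1 c, ?_, ?_⟩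
  · intro f hf
    obtain ⟨c₀, hc₀, hm⟩ := hmarg f hf
    refine ⟨algebraMap ℚ_[p] (PadicAlgCl p) c₀, (map_ne_zero _).mpr hc₀, fun i => ?_⟩
    rw [← map_mul, coeff_padicLFunction,
      ν.coeff_branchSeries_zero_eq_mul_padicLCoeff ⟨hgood, hap⟩ hf hm i]
  · intro ι₀ k g u hk hpk hg hu hcoef
    obtain ⟨Per, Ω, hPer, hΩ, h⟩ := hinterp ι₀ k g u hk hpk hg hu hcoef
    refine ⟨Per, Ω, hPer, hΩ, fun n hn hnk hodd => ?_⟩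
    rw [ν.padicEval₂_branchSeries_arith hν1 hsupp hp5 hk hpk n]
    exact h n hn hnk hodd

open Literature.NumberTheory.EllipticCurves.ModularForms in
/-- **The all-branches Greenberg–Stevens/Kitagawa fact from the Hida family and Kitagawa's measure.**
`greenbergStevens_kitagawa_twoVariable_interpolation_allBranches` follows from the two Λ-adic inputs
(H) `hHida` — the Hida family through `f_E^{(α)}` with `𝕋_𝔪 = Λ` under `(Br)` (Hida 1986; Delbourgo
2008, Thm. 4.4) — and (K) `hMeas` — Kitagawa's two-variable measure for that family with its moment
interpolation (Kitagawa 1994, Thm. 1.1; Greenberg–Stevens 1993, Thm. 5.15; Delbourgo 2008, Thm. 4.11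
as printed, measure form) — via `kitagawaAll_of_kitagawaMeasure` and the classical glue
`greenbergStevens_kitagawa_twoVariable_interpolation_allBranches_of_hidaFamily_of_kitagawa`.
Neither (H) nor (K) is a fact of the tree (D-0026); they are the remaining Λ-adic theory.
[cite: Delbourgo2008, Thm. 4.4, Thm. 4.11, Def. 4.12] [cite: Kitagawa1994, Thm. 1.1]
[cite: GreenbergStevens1993, Thm. 5.15] -/
theorem greenbergStevens_kitagawa_twoVariable_interpolation_allBranches_of_hidaFamily_of_kitagawaMeasure
    (hHida : ∀ (W : WeierstrassCurve ℚ) [W.IsElliptic] [W.IsGloballyMinimal]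
      (_ : NeZero (W.conductorNorm ℤ)) (p : ℕ) [Fact p.Prime], 5 ≤ p → W.HasGoodReductionAtPrime p →
      ¬ (p : ℤ) ∣ W.frobeniusTrace p → W.HasSurjectiveModNGaloisRep p →
      (∀ (M : ℕ) (_ : NeZero M) (g : CuspForm (CongruenceSubgroup.Gamma0 M) 2)
        (ι : coeffField g →+* PadicAlgCl p), M ∣ W.conductorNorm ℤ * p → IsNewform0 g →
        ‖ι ⟨(qExpansion 1 ⇑g).coeff p, coeff_mem_coeffField g p⟩‖ = 1 →
        (∀ ℓ : ℕ, ℓ.Prime → ¬ ℓ ∣ W.conductorNorm ℤ * p →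
          ‖ι ⟨(qExpansion 1 ⇑g).coeff ℓ, coeff_mem_coeffField g ℓ⟩ -
            ((W.frobeniusTrace ℓ : ℤ) : PadicAlgCl p)‖ < 1) →
        M = W.conductorNorm ℤ ∧ ∀ n : ℕ, (qExpansion 1 ⇑g).coeff n = ((W.LFunction n : ℤ) : ℂ)) →
      ∃ A : ℕ → PowerSeries ℚ_[p],
        ((∀ n, IsPadicInt (A n)) ∧
          (∀ n : ℕ, PowerSeries.constantCoeff (A n) =
            ((W.LFunction n : ℤ) : ℚ_[p]) -
              (((W.LFunction p : ℤ) : ℚ_[p]) - (unitRoot W p : ℚ_[p])) *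
                (if p ∣ n then ((W.LFunction (n / p) : ℤ) : ℚ_[p]) else 0)) ∧
          (∀ k : ℤ, 2 < k → ((p : ℤ) - 1) ∣ (k - 2) →
            ∃ (g : CuspForm (CongruenceSubgroup.Gamma0 (W.conductorNorm ℤ)) k)
              (ι₀ : PadicAlgCl p ≃+* ℂ) (u : ℂ), IsNewform0 g ∧
              u ^ 2 - (qExpansion 1 ⇑g).coeff p * u + (p : ℂ) ^ (k - 1) = 0 ∧
              ∀ n : ℕ, ι₀.symm ((qExpansion 1 ⇑(iota (W.conductorNorm ℤ) (W.conductorNorm ℤ * p) 1 k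
                  (mul_dvd_mul_left _ (one_dvd _)) g - ((qExpansion 1 ⇑g).coeff p - u) •
                  iota (W.conductorNorm ℤ) (W.conductorNorm ℤ * p) p k dvd_rfl g)).coeff n) =
                algebraMap ℚ_[p] (PadicAlgCl p) (padicEval (A n) ((1 + (p : ℚ_[p])) ^ (k - 2) - 1)))) ∧
        (∀ (ι₀ : PadicAlgCl p ≃+* ℂ) (k : ℤ)
          (g : CuspForm (CongruenceSubgroup.Gamma0 (W.conductorNorm ℤ)) k),
          2 < k → ((p : ℤ) - 1) ∣ (k - 2) → IsNewform0 g →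
          ‖ι₀.symm ((qExpansion 1 ⇑g).coeff p)‖ = 1 →
          (∀ ℓ : ℕ, ℓ.Prime → ¬ ℓ ∣ W.conductorNorm ℤ * p →
            ‖ι₀.symm ((qExpansion 1 ⇑g).coeff ℓ) - ((W.frobeniusTrace ℓ : ℤ) : PadicAlgCl p)‖ < 1) →
          ∃ u : ℂ, u ^ 2 - (qExpansion 1 ⇑g).coeff p * u + (p : ℂ) ^ (k - 1) = 0 ∧
            ∀ n : ℕ, ι₀.symm ((qExpansion 1 ⇑(iota (W.conductorNorm ℤ) (W.conductorNorm ℤ * p) 1 k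
                (mul_dvd_mul_left _ (one_dvd _)) g - ((qExpansion 1 ⇑g).coeff p - u) •
                iota (W.conductorNorm ℤ) (W.conductorNorm ℤ * p) p k dvd_rfl g)).coeff n) =
              algebraMap ℚ_[p] (PadicAlgCl p) (padicEval (A n) ((1 + (p : ℚ_[p])) ^ (k - 2) - 1))))
    (hMeas : ∀ (W : WeierstrassCurve ℚ) [W.IsElliptic] [W.IsGloballyMinimal]
      (_ : NeZero (W.conductorNorm ℤ)) (p : ℕ) [Fact p.Prime], 5 ≤ p → W.HasGoodReductionAtPrime p →
      ¬ (p : ℤ) ∣ W.frobeniusTrace p → ∀ A : ℕ → PowerSeries ℚ_[p],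
      ((∀ n, IsPadicInt (A n)) ∧
          (∀ n : ℕ, PowerSeries.constantCoeff (A n) =
            ((W.LFunction n : ℤ) : ℚ_[p]) -
              (((W.LFunction p : ℤ) : ℚ_[p]) - (unitRoot W p : ℚ_[p])) *
                (if p ∣ n then ((W.LFunction (n / p) : ℤ) : ℚ_[p]) else 0)) ∧
          (∀ k : ℤ, 2 < k → ((p : ℤ) - 1) ∣ (k - 2) →
            ∃ (g : CuspForm (CongruenceSubgroup.Gamma0 (W.conductorNorm ℤ)) k)
              (ι₀ : PadicAlgCl p ≃+* ℂ) (u : ℂ), IsNewform0 g ∧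
              u ^ 2 - (qExpansion 1 ⇑g).coeff p * u + (p : ℂ) ^ (k - 1) = 0 ∧
              ∀ n : ℕ, ι₀.symm ((qExpansion 1 ⇑(iota (W.conductorNorm ℤ) (W.conductorNorm ℤ * p) 1 k
                  (mul_dvd_mul_left _ (one_dvd _)) g - ((qExpansion 1 ⇑g).coeff p - u) •
                  iota (W.conductorNorm ℤ) (W.conductorNorm ℤ * p) p k dvd_rfl g)).coeff n) =
                algebraMap ℚ_[p] (PadicAlgCl p) (padicEval (A n) ((1 + (p : ℚ_[p])) ^ (k - 2) - 1)))) →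
      ∃ ν : BoundedDistribution (padicIntSq p) ℚ_[p], ν.bound ≤ 1 ∧
        (∀ (L : ℕ) (c : ZMod (p ^ L) × ZMod (p ^ L)), 1 ≤ L → ¬ (IsUnit c.1 ∧ IsUnit c.2) →
          ν.μ L c = 0) ∧
        (∀ f : CuspForm (CongruenceSubgroup.Gamma0 (W.conductorNorm ℤ)) 2, IsNewformOf W f →
          ∃ c₀ : ℚ_[p], c₀ ≠ 0 ∧
            ∀ (n : ℕ) (η₂ : rootsOfUnity (torsionOrder p) ℤ_[p]) (t : ZMod (p ^ n)),
              ∑ η₁ : rootsOfUnity (torsionOrder p) ℤ_[p], ∑ s : ZMod (p ^ n),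
                  ν.μ (cyclotomicExponent p + n)
                    (BoundedDistribution.classOf' n η₁ s, BoundedDistribution.classOf' n η₂ t) =
                c₀ * msdMeasure f (unitRoot W p : ℚ_[p]) (n + cyclotomicExponent p)
                  (classOf p n η₂ t)) ∧
        (∀ (ι₀ : PadicAlgCl p ≃+* ℂ) (k : ℤ)
          (g : CuspForm (CongruenceSubgroup.Gamma0 (W.conductorNorm ℤ)) k) (u : ℂ),
          2 < k → ((p : ℤ) - 1) ∣ (k - 2) → IsNewform0 g →
          u ^ 2 - (qExpansion 1 ⇑g).coeff p * u + (p : ℂ) ^ (k - 1) = 0 →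
          (∀ n : ℕ, ι₀.symm ((qExpansion 1 ⇑(iota (W.conductorNorm ℤ) (W.conductorNorm ℤ * p) 1 k
              (mul_dvd_mul_left _ (one_dvd _)) g - ((qExpansion 1 ⇑g).coeff p - u) •
              iota (W.conductorNorm ℤ) (W.conductorNorm ℤ * p) p k dvd_rfl g)).coeff n) =
            algebraMap ℚ_[p] (PadicAlgCl p) (padicEval (A n) ((1 + (p : ℚ_[p])) ^ (k - 2) - 1))) →
          ∃ (Per : PadicAlgCl p) (Ω : ℂ), Per ≠ 0 ∧ Ω ≠ 0 ∧
            ∀ n : ℕ, 0 < n → (n : ℤ) < k → Odd n →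
              algebraMap ℚ_[p] (PadicAlgCl p)
                  (ν.integral fun zx => (zx.1 : ℚ_[p]) ^ (k - 2).toNat * (zx.2 : ℚ_[p]) ^ (n - 1)) =
                Per * ι₀.symm ((1 - (p : ℂ) ^ (n - 1) / u) *
                  ((2 * Real.pi : ℂ) ^ n *
                    completedLValue
                      (iota (W.conductorNorm ℤ) (W.conductorNorm ℤ * p) 1 k
                          (mul_dvd_mul_left _ (one_dvd _)) g -
                        ((qExpansion 1 ⇑g).coeff p - u) •
                          iota (W.conductorNorm ℤ) (W.conductorNorm ℤ * p) p k dvd_rfl g) n) /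
                  ((2 * Real.pi * Complex.I) ^ (n - 1) * Ω)))) :
    greenbergStevens_kitagawa_twoVariable_interpolation_allBranches :=
  greenbergStevens_kitagawa_twoVariable_interpolation_allBranches_of_hidaFamily_of_kitagawa hHida
    (kitagawaAll_of_kitagawaMeasure hMeas)

open Literature.NumberTheory.EllipticCurves.ModularForms in
/-- **One pair `(hHida, hMeas)` closes both named facts**: the trivial-branch fact
`greenbergStevens_kitagawa_twoVariable_interpolation` also follows from the Hida family (H) and
Kitagawa's measure (K, measure form), via `kitagawaAll_of_kitagawaMeasure`, `kitagawa_of_kitagawaAll`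
and `greenbergStevens_kitagawa_twoVariable_interpolation_of_hidaFamily_of_kitagawaAll`
(Delbourgo 2008, Thm. 4.11: the measure form is printed for every branch at once).
[cite: Delbourgo2008, Thm. 4.11, Def. 4.12] -/
theorem greenbergStevens_kitagawa_twoVariable_interpolation_of_hidaFamily_of_kitagawaMeasure
    (hHida : ∀ (W : WeierstrassCurve ℚ) [W.IsElliptic] [W.IsGloballyMinimal]
      (_ : NeZero (W.conductorNorm ℤ)) (p : ℕ) [Fact p.Prime], 5 ≤ p → W.HasGoodReductionAtPrime p →
      ¬ (p : ℤ) ∣ W.frobeniusTrace p → W.HasSurjectiveModNGaloisRep p →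
      (∀ (M : ℕ) (_ : NeZero M) (g : CuspForm (CongruenceSubgroup.Gamma0 M) 2)
        (ι : coeffField g →+* PadicAlgCl p), M ∣ W.conductorNorm ℤ * p → IsNewform0 g →
        ‖ι ⟨(qExpansion 1 ⇑g).coeff p, coeff_mem_coeffField g p⟩‖ = 1 →
        (∀ ℓ : ℕ, ℓ.Prime → ¬ ℓ ∣ W.conductorNorm ℤ * p →
          ‖ι ⟨(qExpansion 1 ⇑g).coeff ℓ, coeff_mem_coeffField g ℓ⟩ -
            ((W.frobeniusTrace ℓ : ℤ) : PadicAlgCl p)‖ < 1) →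
        M = W.conductorNorm ℤ ∧ ∀ n : ℕ, (qExpansion 1 ⇑g).coeff n = ((W.LFunction n : ℤ) : ℂ)) →
      ∃ A : ℕ → PowerSeries ℚ_[p],
        ((∀ n, IsPadicInt (A n)) ∧
          (∀ n : ℕ, PowerSeries.constantCoeff (A n) =
            ((W.LFunction n : ℤ) : ℚ_[p]) -
              (((W.LFunction p : ℤ) : ℚ_[p]) - (unitRoot W p : ℚ_[p])) *
                (if p ∣ n then ((W.LFunction (n / p) : ℤ) : ℚ_[p]) else 0)) ∧
          (∀ k : ℤ, 2 < k → ((p : ℤ) - 1) ∣ (k - 2) →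
            ∃ (g : CuspForm (CongruenceSubgroup.Gamma0 (W.conductorNorm ℤ)) k)
              (ι₀ : PadicAlgCl p ≃+* ℂ) (u : ℂ), IsNewform0 g ∧
              u ^ 2 - (qExpansion 1 ⇑g).coeff p * u + (p : ℂ) ^ (k - 1) = 0 ∧
              ∀ n : ℕ, ι₀.symm ((qExpansion 1 ⇑(iota (W.conductorNorm ℤ) (W.conductorNorm ℤ * p) 1 k
                  (mul_dvd_mul_left _ (one_dvd _)) g - ((qExpansion 1 ⇑g).coeff p - u) •
                  iota (W.conductorNorm ℤ) (W.conductorNorm ℤ * p) p k dvd_rfl g)).coeff n) =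
                algebraMap ℚ_[p] (PadicAlgCl p) (padicEval (A n) ((1 + (p : ℚ_[p])) ^ (k - 2) - 1)))) ∧
        (∀ (ι₀ : PadicAlgCl p ≃+* ℂ) (k : ℤ)
          (g : CuspForm (CongruenceSubgroup.Gamma0 (W.conductorNorm ℤ)) k),
          2 < k → ((p : ℤ) - 1) ∣ (k - 2) → IsNewform0 g →
          ‖ι₀.symm ((qExpansion 1 ⇑g).coeff p)‖ = 1 →
          (∀ ℓ : ℕ, ℓ.Prime → ¬ ℓ ∣ W.conductorNorm ℤ * p →
            ‖ι₀.symm ((qExpansion 1 ⇑g).coeff ℓ) - ((W.frobeniusTrace ℓ : ℤ) : PadicAlgCl p)‖ < 1) →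
          ∃ u : ℂ, u ^ 2 - (qExpansion 1 ⇑g).coeff p * u + (p : ℂ) ^ (k - 1) = 0 ∧
            ∀ n : ℕ, ι₀.symm ((qExpansion 1 ⇑(iota (W.conductorNorm ℤ) (W.conductorNorm ℤ * p) 1 k
                (mul_dvd_mul_left _ (one_dvd _)) g - ((qExpansion 1 ⇑g).coeff p - u) •
                iota (W.conductorNorm ℤ) (W.conductorNorm ℤ * p) p k dvd_rfl g)).coeff n) =
              algebraMap ℚ_[p] (PadicAlgCl p) (padicEval (A n) ((1 + (p : ℚ_[p])) ^ (k - 2) - 1))))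
    (hMeas : ∀ (W : WeierstrassCurve ℚ) [W.IsElliptic] [W.IsGloballyMinimal]
      (_ : NeZero (W.conductorNorm ℤ)) (p : ℕ) [Fact p.Prime], 5 ≤ p → W.HasGoodReductionAtPrime p →
      ¬ (p : ℤ) ∣ W.frobeniusTrace p → ∀ A : ℕ → PowerSeries ℚ_[p],
      ((∀ n, IsPadicInt (A n)) ∧
          (∀ n : ℕ, PowerSeries.constantCoeff (A n) =
            ((W.LFunction n : ℤ) : ℚ_[p]) -
              (((W.LFunction p : ℤ) : ℚ_[p]) - (unitRoot W p : ℚ_[p])) *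
                (if p ∣ n then ((W.LFunction (n / p) : ℤ) : ℚ_[p]) else 0)) ∧
          (∀ k : ℤ, 2 < k → ((p : ℤ) - 1) ∣ (k - 2) →
            ∃ (g : CuspForm (CongruenceSubgroup.Gamma0 (W.conductorNorm ℤ)) k)
              (ι₀ : PadicAlgCl p ≃+* ℂ) (u : ℂ), IsNewform0 g ∧
              u ^ 2 - (qExpansion 1 ⇑g).coeff p * u + (p : ℂ) ^ (k - 1) = 0 ∧
              ∀ n : ℕ, ι₀.symm ((qExpansion 1 ⇑(iota (W.conductorNorm ℤ) (W.conductorNorm ℤ * p) 1 k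
                  (mul_dvd_mul_left _ (one_dvd _)) g - ((qExpansion 1 ⇑g).coeff p - u) •
                  iota (W.conductorNorm ℤ) (W.conductorNorm ℤ * p) p k dvd_rfl g)).coeff n) =
                algebraMap ℚ_[p] (PadicAlgCl p) (padicEval (A n) ((1 + (p : ℚ_[p])) ^ (k - 2) - 1)))) →
      ∃ ν : BoundedDistribution (padicIntSq p) ℚ_[p], ν.bound ≤ 1 ∧
        (∀ (L : ℕ) (c : ZMod (p ^ L) × ZMod (p ^ L)), 1 ≤ L → ¬ (IsUnit c.1 ∧ IsUnit c.2) →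
          ν.μ L c = 0) ∧
        (∀ f : CuspForm (CongruenceSubgroup.Gamma0 (W.conductorNorm ℤ)) 2, IsNewformOf W f →
          ∃ c₀ : ℚ_[p], c₀ ≠ 0 ∧
            ∀ (n : ℕ) (η₂ : rootsOfUnity (torsionOrder p) ℤ_[p]) (t : ZMod (p ^ n)),
              ∑ η₁ : rootsOfUnity (torsionOrder p) ℤ_[p], ∑ s : ZMod (p ^ n),
                  ν.μ (cyclotomicExponent p + n)
                    (BoundedDistribution.classOf' n η₁ s, BoundedDistribution.classOf' n η₂ t) =
                c₀ * msdMeasure f (unitRoot W p : ℚ_[p]) (n + cyclotomicExponent p)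
                  (classOf p n η₂ t)) ∧
        (∀ (ι₀ : PadicAlgCl p ≃+* ℂ) (k : ℤ)
          (g : CuspForm (CongruenceSubgroup.Gamma0 (W.conductorNorm ℤ)) k) (u : ℂ),
          2 < k → ((p : ℤ) - 1) ∣ (k - 2) → IsNewform0 g →
          u ^ 2 - (qExpansion 1 ⇑g).coeff p * u + (p : ℂ) ^ (k - 1) = 0 →
          (∀ n : ℕ, ι₀.symm ((qExpansion 1 ⇑(iota (W.conductorNorm ℤ) (W.conductorNorm ℤ * p) 1 k
              (mul_dvd_mul_left _ (one_dvd _)) g - ((qExpansion 1 ⇑g).coeff p - u) •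
              iota (W.conductorNorm ℤ) (W.conductorNorm ℤ * p) p k dvd_rfl g)).coeff n) =
            algebraMap ℚ_[p] (PadicAlgCl p) (padicEval (A n) ((1 + (p : ℚ_[p])) ^ (k - 2) - 1))) →
          ∃ (Per : PadicAlgCl p) (Ω : ℂ), Per ≠ 0 ∧ Ω ≠ 0 ∧
            ∀ n : ℕ, 0 < n → (n : ℤ) < k → Odd n →
              algebraMap ℚ_[p] (PadicAlgCl p)
                  (ν.integral fun zx => (zx.1 : ℚ_[p]) ^ (k - 2).toNat * (zx.2 : ℚ_[p]) ^ (n - 1)) =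
                Per * ι₀.symm ((1 - (p : ℂ) ^ (n - 1) / u) *
                  ((2 * Real.pi : ℂ) ^ n *
                    completedLValue
                      (iota (W.conductorNorm ℤ) (W.conductorNorm ℤ * p) 1 k
                          (mul_dvd_mul_left _ (one_dvd _)) g -
                        ((qExpansion 1 ⇑g).coeff p - u) •
                          iota (W.conductorNorm ℤ) (W.conductorNorm ℤ * p) p k dvd_rfl g) n) /
                  ((2 * Real.pi * Complex.I) ^ (n - 1) * Ω)))) :
    greenbergStevens_kitagawa_twoVariable_interpolation :=
  greenbergStevens_kitagawa_twoVariable_interpolation_of_hidaFamily_of_kitagawaAll hHida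
    (kitagawaAll_of_kitagawaMeasure hMeas)

end MeasureForm

end Literature.NumberTheory.EllipticCurves

end
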